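import Literature.NumberTheory.Automorphic.LocalLanglandsDatumProofs
import Literature.NumberTheory.Automorphic.LocalConstantsCanonical
import HarnessLib

/-!
# Canonically normalised local Langlands data: reduction to Deligne's canonical local constants
# and lang.S09, and the converse

Topic `Literature/NumberTheory/Automorphic`, sibling of `LocalLanglandsDatum` /
`LocalLanglandsDatumProofs` (the structure `LocalLanglandsDatum F` bundling a local Langlands
correspondence for the general linear groups over a non-archimedean local field `F`, and the
reduction of its inhabitedness to the named facts `localLanglands_gl` + `nonempty_localEpsilonSystem`)
and of `LocalConstantsCanonical` (the named fact `nonempty_localEpsilonSystem_isCanonical F`: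
Deligne's local constants normalised against THE Artin maps of local class field theory at every
finite extension `E/F`, Deligne 1973 Thm. 4.1 / Thm. 6.5).

A local Langlands datum `L` is **canonically normalised (pinned)** when its own local Artin datum
is THE Artin map of `F`, `L.artin.IsCanonical` (`LocalArtinData.IsCanonical d :⇔ d.artin =
canonicalArtin F`, `LocalClassFieldTheory`), and the Artin data of its system of local constants
are canonical at every finite extension, `∀ E, (L.eps.artin E).IsCanonical` — Harris–Taylor's
normalisation (Introduction: the canonical `Art_K`, property 1 `rec_K(χ) = χ ∘ Art_K⁻¹`,
property 2 with Deligne's `ε`).  These two pins are, verbatim, the fields `llc_isCanonical`,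
`llc_eps_isCanonical` that the summit `Langlands` imposes on its reciprocity data at every
completion of a number field (prose only; a Literature file imports no `Summits.*`), so
"`Nonempty (Summit.Langlands.ReciprocityData K)`" is "a pinned `LocalLanglandsDatum (K_v)` exists at
every finite place `v`".  This file settles what a pinned datum over ONE local field amounts to.

## Results (theorems only; no definition, no new named fact)

* `LocalLanglandsDatum.isCanonical_artin_of_eps` — the first pin follows from the second at
  `E := F` (`L.eps_artin : L.eps.artin F = L.artin`).
* `LocalLanglandsDatum.exists_isCanonical_of_isLocalLanglandsGL` — a system of local constants `𝓔`
  canonical at every finite extension and a family `rec` with `IsLocalLanglandsGL F … (𝓔.artin F) 𝓔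
  rec` (any proofs of the threaded facts) assemble to a pinned datum;
  `…_of_localLanglands_gl` — the same from the existence statement **lang.S09** at `(𝓔.artin F, 𝓔)`.
* `LocalLanglandsDatum.exists_isCanonical_of` — **a pinned datum over `F` exists, CONDITIONALLY on
  the two named facts at `F`**: `nonempty_localEpsilonSystem_isCanonical F` (Deligne 1973) and
  `localLanglands_gl F … (𝓔.artin F) 𝓔 rfl` for every `𝓔` (Harris–Taylor 2001 Thm. A / Henniart 2000
  Thm. 1.2, at the discharged threaded facts — the hypothesis shape of the accepted
  `LocalLanglandsDatum.nonempty_of`); `…_forall_of` — the same over every `F : Type` at once.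
* Converses: `LocalLanglandsDatum.nonempty_localEpsilonSystem_isCanonical_of_eps` (a datum with the
  second pin GIVES Deligne's canonical fact at `F`) and `LocalLanglandsDatum.exists_isLocalLanglandsGL_eps`
  (any datum gives the existence half of lang.S09 normalised by `(L.eps.artin F, L.eps)`, at the
  discharged threaded facts); packaged as `LocalLanglandsDatum.exists_isCanonical_iff` — **a pinned
  datum over `F` exists iff there are a canonical `𝓔` and a family `rec` with
  `IsLocalLanglandsGL F … (𝓔.artin F) 𝓔 rec`**: Deligne's Thm. 4.1 and Harris–Taylor's Thm. A for `F`,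
  nothing less.  In particular no pinned datum — hence no reciprocity datum of a number field — is
  cheaper than the local Langlands correspondence for `GL_n(F)` itself; the tree has neither
  `localLanglands_gl_holds` nor `nonempty_localEpsilonSystem_isCanonical_holds` (each a theory).
* Not imported here (to keep this leaf light): for TOTALLY REAL number fields a pinned family
  `llc : ∀ v, LocalLanglandsDatum (K_v)` is also the first half of the named fact
  `galoisRep_GL2_totallyReal_localGlobal_pinned` (`HilbertModularLocalGlobalPinned`, undischarged).

## References

* M. Harris, R. Taylor, *The geometry and cohomology of some simple Shimura varieties*, Ann. of
  Math. Stud. 151 (2001): Introduction, Theorem A ("A local Langlands correspondence `rec_K` exists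
  for any finite extension `K/ℚ_p`", p. 2) and properties 1–2 of `rec_K`. [HarrisTaylorAMS2001]
* G. Henniart, *Une preuve simple des conjectures de Langlands pour GL(n) sur un corps p-adique*,
  Invent. Math. 139 (2000), Thm. 1.2. [HenniartInventiones2000]
* P. Deligne, *Les constantes des équations fonctionnelles des fonctions L*, Antwerp II, LNM 349
  (1973), §2.3, Thm. 4.1, Thm. 6.5. [Deligne1973Constantes]
-/

noncomputable section

open scoped MatrixGroups

namespace Literature.NumberTheory.Automorphic

namespace LocalLanglandsDatum

open Literature.NumberTheory.GaloisRepresentations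

variable {F : Type} [Field F] [ValuativeRel F] [TopologicalSpace F] [IsNonarchimedeanLocalField F]

/-! ### The two pins -/

/-- **The first pin follows from the second at `E := F`**: if the Artin datum of `L`'s local
constants over `F` itself is canonical then so is `L.artin`, because they are equal
(`L.eps_artin`). [folklore] -/
theorem isCanonical_artin_of_eps (L : LocalLanglandsDatum F) (h : (L.eps.artin F).IsCanonical) :
    L.artin.IsCanonical :=
  L.eps_artin ▸ h

/-- Conversely the first pin gives the second at the base field `E := F`. [folklore] -/
theorem isCanonical_eps_self_of_artin (L : LocalLanglandsDatum F) (h : L.artin.IsCanonical) :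
    (L.eps.artin F).IsCanonical := by
  rw [L.eps_artin]
  exact h

/-! ### Assembly: a pinned datum from canonical local constants and a correspondence -/

/-- **A pinned local Langlands datum from its two constituents.**  A system of local constants `𝓔`
over `F` whose Artin data are canonical at every finite extension `E/F`, and a family
`rec_n : Irr(GL_n(F)) → {Frobenius-semisimple WD reps}/≅` with the six-clause property
`IsLocalLanglandsGL F … (𝓔.artin F) 𝓔 rec` (for any proofs of the threaded facts), give a datum with
BOTH pins: its Artin datum is `𝓔.artin F` (so `eps_artin` is `rfl` and the first pin is the
hypothesis at `E := F`), the field `hqc` is the discharged `isOpen_ker_quasiChar_holds`.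
[cite: HarrisTaylorAMS2001, Thm. A] -/
theorem exists_isCanonical_of_isLocalLanglandsGL {hmul : IsFrobPow.mul (F := F)}
    {huniq : IsFrobPow.unique (F := F)} {hn : absInertia_normal F} {hex : exists_isFrobPow (F := F)}
    {hns : WeilGroup.exists_subgroup_le_inertia_isOpen_of_continuous (F := F)}
    {𝓔 : LocalEpsilonSystem F}
    (h𝓔 : ∀ (E : Type) [Field E] [ValuativeRel E] [TopologicalSpace E] [IsNonarchimedeanLocalField E]
      [Algebra F E] [FiniteDimensional F E], (𝓔.artin E).IsCanonical)
    {rec : ∀ n : ℕ, IrrClass (GL (Fin n) F) → Quotient (frobSemisimpleWDSetoid F n)}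
    (hrec : IsLocalLanglandsGL F hmul huniq hn hex hns (𝓔.artin F) 𝓔 rec) :
    ∃ L : LocalLanglandsDatum F, L.artin.IsCanonical ∧
      ∀ (E : Type) [Field E] [ValuativeRel E] [TopologicalSpace E] [IsNonarchimedeanLocalField E]
        [Algebra F E] [FiniteDimensional F E], (L.eps.artin E).IsCanonical :=
  ⟨{ hmul := hmul, huniq := huniq, hn := hn, hex := hex, hns := hns,
     hqc := isOpen_ker_quasiChar_holds, artin := 𝓔.artin F, eps := 𝓔, eps_artin := rfl,
     recGL := rec, isLocalLanglands := hrec },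
    h𝓔 F, fun E _ _ _ _ _ _ => h𝓔 E⟩

/-- The same from the existence statement **lang.S09** `localLanglands_gl F … (𝓔.artin F) 𝓔 rfl`
(a correspondence normalised by `(𝓔.artin F, 𝓔)`, unique on supercuspidals) for a canonical `𝓔`:
keep its existence half. [cite: HarrisTaylorAMS2001, Thm. A] -/
theorem exists_isCanonical_of_localLanglands_gl {hmul : IsFrobPow.mul (F := F)}
    {huniq : IsFrobPow.unique (F := F)} {hn : absInertia_normal F} {hex : exists_isFrobPow (F := F)}
    {hns : WeilGroup.exists_subgroup_le_inertia_isOpen_of_continuous (F := F)}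
    {𝓔 : LocalEpsilonSystem F}
    (h𝓔 : ∀ (E : Type) [Field E] [ValuativeRel E] [TopologicalSpace E] [IsNonarchimedeanLocalField E]
      [Algebra F E] [FiniteDimensional F E], (𝓔.artin E).IsCanonical)
    (h : localLanglands_gl F hmul huniq hn hex hns (𝓔.artin F) 𝓔 rfl) :
    ∃ L : LocalLanglandsDatum F, L.artin.IsCanonical ∧
      ∀ (E : Type) [Field E] [ValuativeRel E] [TopologicalSpace E] [IsNonarchimedeanLocalField E]
        [Algebra F E] [FiniteDimensional F E], (L.eps.artin E).IsCanonical := by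
  obtain ⟨rec, hrec, -⟩ := h
  exact exists_isCanonical_of_isLocalLanglandsGL h𝓔 hrec

/-- **A pinned local Langlands datum over `F` exists, conditionally on the two named facts at `F`**:
Deligne's local constants normalised against THE Artin maps (`nonempty_localEpsilonSystem_isCanonical
F`, Deligne 1973 Thm. 4.1 / Thm. 6.5) and the local Langlands correspondence for the general linear
groups over `F` (`localLanglands_gl F … (𝓔.artin F) 𝓔 rfl` for every system of local constants `𝓔`
— Harris–Taylor 2001 Thm. A, Henniart 2000 Thm. 1.2 — at the discharged proofs of the threaded
`LocalGaloisGroup`/`LocalConstants` facts; the hypothesis shape of the accepted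
`LocalLanglandsDatum.nonempty_of`, to which anyone holding the fact for all `(d, 𝓔, hd)`
specialises).  CONDITIONAL RESULT: neither hypothesis is proved in the tree.
[cite: HarrisTaylorAMS2001, Thm. A] [cite: HenniartInventiones2000, Thm. 1.2]
[cite: Deligne1973Constantes, Thm. 4.1] -/
theorem exists_isCanonical_of (hε : nonempty_localEpsilonSystem_isCanonical F)
    (hLLC : ∀ 𝓔 : LocalEpsilonSystem F,
      localLanglands_gl F IsFrobPow.mul_holds IsFrobPow.unique_holds (absInertia_normal_holds F)
        (exists_isFrobPow_holds F) WeilGroup.exists_subgroup_le_inertia_isOpen_of_continuous_holds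
        (𝓔.artin F) 𝓔 rfl) :
    ∃ L : LocalLanglandsDatum F, L.artin.IsCanonical ∧
      ∀ (E : Type) [Field E] [ValuativeRel E] [TopologicalSpace E] [IsNonarchimedeanLocalField E]
        [Algebra F E] [FiniteDimensional F E], (L.eps.artin E).IsCanonical := by
  obtain ⟨𝓔, h𝓔⟩ := hε
  exact exists_isCanonical_of_localLanglands_gl (fun E _ _ _ _ _ _ => h𝓔 E) (hLLC 𝓔)

/-- **Pinned local Langlands data exist over every non-archimedean local field in `Type`,
conditionally on the two named facts over every such field** (`exists_isCanonical_of`, fieldwise).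
This is exactly the input from which reciprocity data of every number field are assembled at the
completions `K_v`. [cite: HarrisTaylorAMS2001, Thm. A] [cite: Deligne1973Constantes, Thm. 4.1] -/
theorem exists_isCanonical_forall_of
    (hε : ∀ (F : Type) [Field F] [ValuativeRel F] [TopologicalSpace F] [IsNonarchimedeanLocalField F],
      nonempty_localEpsilonSystem_isCanonical F)
    (hLLC : ∀ (F : Type) [Field F] [ValuativeRel F] [TopologicalSpace F]
      [IsNonarchimedeanLocalField F] (𝓔 : LocalEpsilonSystem F),
      localLanglands_gl F IsFrobPow.mul_holds IsFrobPow.unique_holds (absInertia_normal_holds F)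
        (exists_isFrobPow_holds F) WeilGroup.exists_subgroup_le_inertia_isOpen_of_continuous_holds
        (𝓔.artin F) 𝓔 rfl)
    (F : Type) [Field F] [ValuativeRel F] [TopologicalSpace F] [IsNonarchimedeanLocalField F] :
    ∃ L : LocalLanglandsDatum F, L.artin.IsCanonical ∧
      ∀ (E : Type) [Field E] [ValuativeRel E] [TopologicalSpace E] [IsNonarchimedeanLocalField E]
        [Algebra F E] [FiniteDimensional F E], (L.eps.artin E).IsCanonical :=
  exists_isCanonical_of (hε F) (hLLC F)

/-! ### Converse: what a pinned datum delivers -/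

/-- **A datum with the second pin delivers Deligne's canonical fact at `F`**:
`nonempty_localEpsilonSystem_isCanonical F`, witnessed by `L.eps`. [cite: Deligne1973Constantes, Thm. 4.1] -/
theorem nonempty_localEpsilonSystem_isCanonical_of_eps (L : LocalLanglandsDatum F)
    (hLE : ∀ (E : Type) [Field E] [ValuativeRel E] [TopologicalSpace E] [IsNonarchimedeanLocalField E]
      [Algebra F E] [FiniteDimensional F E], (L.eps.artin E).IsCanonical) :
    nonempty_localEpsilonSystem_isCanonical F :=
  ⟨L.eps, fun E _ _ _ _ _ _ => hLE E⟩

/-- **Any datum delivers the existence half of lang.S09 normalised by its own local constants**: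
a family `rec` with `IsLocalLanglandsGL F … (L.eps.artin F) L.eps rec`, stated at the DISCHARGED
proofs of the threaded facts (they are propositions, so `L.isLocalLanglands` has this type once the
datum's `eps_artin : L.eps.artin F = L.artin` is rewritten). [cite: HarrisTaylorAMS2001, Thm. A] -/
theorem exists_isLocalLanglandsGL_eps (L : LocalLanglandsDatum F) :
    ∃ rec : ∀ n : ℕ, IrrClass (GL (Fin n) F) → Quotient (frobSemisimpleWDSetoid F n),
      IsLocalLanglandsGL F IsFrobPow.mul_holds IsFrobPow.unique_holds (absInertia_normal_holds F)
        (exists_isFrobPow_holds F) WeilGroup.exists_subgroup_le_inertia_isOpen_of_continuous_holds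
        (L.eps.artin F) L.eps rec := by
  refine ⟨L.recGL, ?_⟩
  have h := L.isLocalLanglands
  rw [← L.eps_artin] at h
  exact h

/-- **What a pinned local Langlands datum over `F` amounts to**: one exists iff there are a system
of local constants `𝓔` canonical at every finite extension `E/F` (Deligne 1973, Thm. 4.1 for THE
Artin maps) and a local Langlands correspondence `rec` for the general linear groups over `F`
normalised by `(𝓔.artin F, 𝓔)` (`IsLocalLanglandsGL`, Harris–Taylor 2001 Thm. A (i)–(v), at the
discharged threaded facts) — nothing less and nothing more.  Forward: `𝓔 := L.eps`, `rec := L.recGL`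
(`exists_isLocalLanglandsGL_eps`); backward: `exists_isCanonical_of_isLocalLanglandsGL`.
[cite: HarrisTaylorAMS2001, Thm. A] [cite: Deligne1973Constantes, Thm. 4.1] -/
theorem exists_isCanonical_iff :
    (∃ L : LocalLanglandsDatum F, L.artin.IsCanonical ∧
      ∀ (E : Type) [Field E] [ValuativeRel E] [TopologicalSpace E] [IsNonarchimedeanLocalField E]
        [Algebra F E] [FiniteDimensional F E], (L.eps.artin E).IsCanonical) ↔
    ∃ (𝓔 : LocalEpsilonSystem F)
      (rec : ∀ n : ℕ, IrrClass (GL (Fin n) F) → Quotient (frobSemisimpleWDSetoid F n)),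
      (∀ (E : Type) [Field E] [ValuativeRel E] [TopologicalSpace E] [IsNonarchimedeanLocalField E]
        [Algebra F E] [FiniteDimensional F E], (𝓔.artin E).IsCanonical) ∧
      IsLocalLanglandsGL F IsFrobPow.mul_holds IsFrobPow.unique_holds (absInertia_normal_holds F)
        (exists_isFrobPow_holds F) WeilGroup.exists_subgroup_le_inertia_isOpen_of_continuous_holds
        (𝓔.artin F) 𝓔 rec := by
  refine ⟨fun ⟨L, _, hLE⟩ => ?_, fun ⟨𝓔, rec, h𝓔, hrec⟩ => ?_⟩
  · obtain ⟨rec, hrec⟩ := L.exists_isLocalLanglandsGL_eps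
    exact ⟨L.eps, rec, fun E _ _ _ _ _ _ => hLE E, hrec⟩
  · exact exists_isCanonical_of_isLocalLanglandsGL (fun E _ _ _ _ _ _ => h𝓔 E) hrec

/-- The weaker one-pin form suffices: a datum whose local constants are canonical at every finite
extension is pinned (`isCanonical_artin_of_eps`). [folklore] -/
theorem exists_isCanonical_iff_eps :
    (∃ L : LocalLanglandsDatum F, L.artin.IsCanonical ∧
      ∀ (E : Type) [Field E] [ValuativeRel E] [TopologicalSpace E] [IsNonarchimedeanLocalField E]
        [Algebra F E] [FiniteDimensional F E], (L.eps.artin E).IsCanonical) ↔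
    ∃ L : LocalLanglandsDatum F,
      ∀ (E : Type) [Field E] [ValuativeRel E] [TopologicalSpace E] [IsNonarchimedeanLocalField E]
        [Algebra F E] [FiniteDimensional F E], (L.eps.artin E).IsCanonical :=
  ⟨fun ⟨L, _, hLE⟩ => ⟨L, hLE⟩, fun ⟨L, hLE⟩ => ⟨L, L.isCanonical_artin_of_eps (hLE F), hLE⟩⟩

end LocalLanglandsDatum

end Literature.NumberTheory.Automorphic

end
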